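import Mathlib
import HarnessLib

/-!
# Unipotent automorphisms of ARBITRARY level on the cotangent space of a local ring (crux `WildQuotients.WildQuotientResolution`, Phase 0)

Crux stmt-ResolutionOfSingularities-15640 (`WildQuotientResolution`), line `Sketch` (card
`p-closure-sylow-separation`), registered stub `stub_phaseZeroHighDim` (= PhaseZeroModel for
`dim X′ ≥ 3`: a `G`-equivariant proper birational REGULAR model on which every inertia group is
p-closed). The local algebra of Phase 0 landed so far is dimension-bound through ONE computation:
how large a `p`-power of a residue-trivial automorphism `g` acting unipotently on `V = 𝔪/𝔪²` is
needed before it acts trivially on `V`. `BorelCore.pow_apply_sub_sub_nsmul_mem`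
(`Theorems/…StubBorelCore.lean`) is level two (`N² ≡ 0`, `g ^ p`), `FlagCore.pow_apply_sub_mem_of_flag`
(`Theorems/…StubFlagCore.lean`) is level three (`N³ ≡ 0`, `g ^ (p ^ 2)`), both by explicit
binomial identities. This Mathlib-only file does the computation in every level at once:

**Theorem** (`cotangentTrivial_pow_of_iterate_sub`). Let `φ` be a residue-trivial automorphism of
a local ring `(R, 𝔪)` with `p ∈ 𝔪` (`p` prime), and suppose the `n`-th iterate of the difference
operator `δ r := φ r - r` maps `𝔪` into `𝔪²`. If `n ≤ p ^ N` then `φ ^ (p ^ N)` acts trivially on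
`𝔪/𝔪²`.

Proof: in the endomorphism ring `AddMonoid.End R` write `φ = 1 + δ` and expand
`(1 + δ) ^ (p ^ N)` (`Commute.add_pow`); the extreme term `δ ^ (p ^ N)` lands in `𝔪²` by the
level bound (`δ` preserves `𝔪²`), and every middle coefficient `(p ^ N).choose k`,
`0 < k < p ^ N`, is divisible by `p` (`Nat.Prime.dvd_choose_pow`) while `p ∈ 𝔪` and `δ R ⊆ 𝔪`.
The companion `iterate_sub_mem_of_flag` produces the level bound from a flag lowered one step by
`δ`, and `pi_eq_one_of_pow_eq_one` is the torsion-freeness of a Pi-product of character targets;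
together they feed `FlagCore.hasNormalSylow_of_character` in the complete-flag theorem
(`Theorems/…FlagCoreGeneral.lean`).

[OURS · crux stmt-ResolutionOfSingularities-15640 · helper toward `stub_phaseZeroHighDim`; folklore
local algebra, counted 0; AI-level work, weaker than expert review.]

* `pi_eq_one_of_pow_eq_one` — a Pi-product of monoids without `n`-torsion has no `n`-torsion.
* `ringEquiv_apply_sub_mem_maximalIdeal_pow` — `φ x - x ∈ 𝔪ⁿ` for `x ∈ 𝔪ⁿ`.
* `cotangentTrivial_pow_of_iterate_sub` — the theorem.
* `iterate_sub_mem_of_flag` — an automorphism lowering a flag by one step lowers it by `k` steps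
  after `k` iterations of its difference operator.
-/

-- single-problem summit: the doubled namespace component `ResolutionOfSingularities` is forced
set_option linter.dupNamespace false

open IsLocalRing

namespace Summit.ResolutionOfSingularities.ResolutionOfSingularities.Theorems.WildQuotientResolution.UnipotentLevel

/-! ## Pi-products of monoids without `n`-torsion -/

/-- If no factor `A i` has a non-trivial element killed by `n`, neither has the product `Π i, A i`
(the target of a tuple of characters; the binary case is `FlagCore.prod_eq_one_of_pow_eq_one`).
[folklore] -/
theorem pi_eq_one_of_pow_eq_one {ι : Type*} {A : ι → Type*} [∀ i, Monoid (A i)] {n : ℕ}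
    (hA : ∀ (i : ι) (a : A i), a ^ n = 1 → a = 1) :
    ∀ x : (∀ i, A i), x ^ n = 1 → x = 1 := fun x hx =>
  funext fun i => hA i (x i) (by rw [← Pi.pow_apply, hx, Pi.one_apply])

section LocalRing

variable {R : Type*} [CommRing R] [IsLocalRing R]

/-- A ring automorphism of a local ring moves every element of `𝔪ⁿ` inside `𝔪ⁿ`: `φ x - x ∈ 𝔪ⁿ`
for `x ∈ 𝔪ⁿ` (`φ(𝔪) ⊆ 𝔪` because `φ` detects units, then `Ideal.map_pow`). [folklore] -/
theorem ringEquiv_apply_sub_mem_maximalIdeal_pow (φ : R ≃+* R) (n : ℕ) {x : R}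
    (hx : x ∈ maximalIdeal R ^ n) : φ x - x ∈ maximalIdeal R ^ n := by
  have hle : Ideal.map (φ : R →+* R) (maximalIdeal R) ≤ maximalIdeal R := by
    rw [Ideal.map_le_iff_le_comap]
    intro y hy
    rw [Ideal.mem_comap, mem_maximalIdeal, mem_nonunits_iff]
    rw [mem_maximalIdeal, mem_nonunits_iff] at hy
    intro hu
    exact hy (by simpa using hu.map φ.symm)
  have hpow : Ideal.map (φ : R →+* R) (maximalIdeal R ^ n) ≤ maximalIdeal R ^ n := by
    rw [Ideal.map_pow]
    exact Ideal.pow_right_mono hle n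
  exact sub_mem (hpow (Ideal.mem_map_of_mem _ hx)) hx

/-! ## The binomial step in arbitrary level -/

/-- **Unipotent of level `n ≤ p ^ N` on `𝔪/𝔪²` ⟹ the `p ^ N`-th power is cotangent-trivial.**
Let `φ` be a residue-trivial automorphism of the local ring `(R, 𝔪)` (`φ r - r ∈ 𝔪` for all `r`)
with `p ∈ 𝔪` for a prime `p`, and suppose the `n`-th iterate of the difference operator
`δ r := φ r - r` maps `𝔪` into `𝔪²`. Then for `n ≤ p ^ N` and every `r ∈ 𝔪`,
`φ ^ (p ^ N) r - r ∈ 𝔪²` (binomial expansion of `(1 + δ) ^ (p ^ N)` in `AddMonoid.End R`: the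
middle coefficients are divisible by `p`, the last term is `δ ^ (p ^ N)`). [folklore] -/
theorem cotangentTrivial_pow_of_iterate_sub (p : ℕ) [hp : Fact p.Prime] (φ : R ≃+* R)
    (hres : ∀ r : R, φ r - r ∈ maximalIdeal R) (hpm : (p : R) ∈ maximalIdeal R)
    {n N : ℕ} (hn : n ≤ p ^ N)
    (hnil : ∀ r ∈ maximalIdeal R, (fun x => φ x - x)^[n] r ∈ maximalIdeal R ^ 2) :
    ∀ r ∈ maximalIdeal R, (φ ^ p ^ N) r - r ∈ maximalIdeal R ^ 2 := by
  classical
  intro r hr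
  -- the difference operator `δ = φ - 1` as an element of the (noncommutative) ring `AddMonoid.End R`
  let Φ : AddMonoid.End R := (φ : R →+ R)
  set D : AddMonoid.End R := Φ - 1 with hDdef
  have happ_add : ∀ (f g : AddMonoid.End R) (y : R), (f + g) y = f y + g y := fun _ _ _ => rfl
  have happ_mul : ∀ (f g : AddMonoid.End R) (y : R), (f * g) y = f (g y) := fun _ _ _ => rfl
  have happ_one : ∀ y : R, (1 : AddMonoid.End R) y = y := fun _ => rfl
  have happ_nat : ∀ (c : ℕ) (y : R), (c : AddMonoid.End R) y = c • y := fun _ _ => rfl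
  have hD : ∀ y : R, D y = φ y - y := fun _ => rfl
  have hsum : ∀ (s : Finset ℕ) (F : ℕ → AddMonoid.End R) (y : R),
      (∑ i ∈ s, F i) y = ∑ i ∈ s, F i y := by
    intro s F y
    induction s using Finset.induction_on with
    | empty => rw [Finset.sum_empty, Finset.sum_empty]; rfl
    | insert a s ha ih => rw [Finset.sum_insert ha, Finset.sum_insert ha, happ_add, ih]
  -- iterates of `δ`: `D ^ m` is the `m`-th iterate; it maps `R` into `𝔪` (`m ≥ 1`) and `𝔪²` into `𝔪²`
  have hDpow : ∀ (m : ℕ) (y : R), (D ^ m) y = (fun x => φ x - x)^[m] y := by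
    intro m y
    rw [AddMonoid.End.coe_pow]
    rfl
  have hDm : ∀ y : R, D y ∈ maximalIdeal R := fun y => by rw [hD]; exact hres y
  have hD2 : ∀ y ∈ maximalIdeal R ^ 2, D y ∈ maximalIdeal R ^ 2 := fun y hy => by
    rw [hD]; exact ringEquiv_apply_sub_mem_maximalIdeal_pow φ 2 hy
  have hDsucc : ∀ (m : ℕ) (y : R), (D ^ (m + 1)) y ∈ maximalIdeal R := fun m y => by
    rw [pow_succ' D m, happ_mul]; exact hDm _
  have hDpow2 : ∀ (m : ℕ), ∀ y ∈ maximalIdeal R ^ 2, (D ^ m) y ∈ maximalIdeal R ^ 2 := by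
    intro m
    induction m with
    | zero => intro y hy; rw [pow_zero, happ_one]; exact hy
    | succ m ih => intro y hy; rw [pow_succ' D m, happ_mul]; exact hD2 _ (ih y hy)
  have hmm : ∀ x ∈ maximalIdeal R, ∀ y ∈ maximalIdeal R, x * y ∈ maximalIdeal R ^ 2 :=
    fun x hx y hy => by rw [pow_two]; exact Ideal.mul_mem_mul hx hy
  -- the level bound: `δ ^ (p ^ N) r ∈ 𝔪²`
  have hDM : (D ^ p ^ N) r ∈ maximalIdeal R ^ 2 := by
    rw [← Nat.sub_add_cancel hn, pow_add, happ_mul]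
    exact hDpow2 (p ^ N - n) _ (by rw [hDpow]; exact hnil r hr)
  -- `φ ^ (p ^ N) = (δ + 1) ^ (p ^ N)` pointwise
  have hφD : (φ ^ p ^ N) r = ((D + 1) ^ p ^ N) r := by
    rw [RingAut.coe_pow, AddMonoid.End.coe_pow]
    have h1 : ⇑(D + 1) = ⇑φ := funext fun y => by rw [happ_add, hD, happ_one, sub_add_cancel]
    rw [h1]
  -- binomial expansion
  have hbin := (Commute.one_right D).add_pow (p ^ N)
  simp only [one_pow, mul_one] at hbin
  have hexp : ((D + 1) ^ p ^ N) r =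
      ∑ m ∈ Finset.range (p ^ N + 1), (p ^ N).choose m • (D ^ m) r := by
    rw [hbin, hsum]
    refine Finset.sum_congr rfl fun m _ => ?_
    rw [happ_mul, happ_nat, map_nsmul]
  rw [hφD, hexp, Finset.sum_range_succ', Nat.choose_zero_right, one_nsmul, pow_zero, happ_one,
    add_sub_cancel_right]
  refine Ideal.sum_mem _ fun m hm => ?_
  rw [Finset.mem_range] at hm
  by_cases hmM : m + 1 = p ^ N
  · rw [hmM]
    exact Submodule.smul_of_tower_mem _ _ hDM
  · obtain ⟨d, hd⟩ := hp.out.dvd_choose_pow (Nat.succ_ne_zero m) hmM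
    rw [hd, mul_nsmul]
    exact Submodule.smul_of_tower_mem _ d (by rw [nsmul_eq_mul]; exact hmm _ hpm _ (hDsucc m r))

/-! ## Flags lowered one step -/

omit [IsLocalRing R] in
/-- **An automorphism lowering a flag by one step lowers it by `k` steps after `k` iterations**:
if `φ r - r ∈ K i` for all `r ∈ K (i + 1)` and all `i < n`, then the `k`-th iterate of
`δ r := φ r - r` maps `K (i + k)` into `K i` whenever `i + k ≤ n`. With `K 0 ≤ 𝔪²` and
`𝔪 ≤ K n` this is the level bound of `cotangentTrivial_pow_of_iterate_sub`. [folklore] -/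
theorem iterate_sub_mem_of_flag (φ : R ≃+* R) (n : ℕ) (K : ℕ → Ideal R)
    (hstep : ∀ i < n, ∀ r ∈ K (i + 1), φ r - r ∈ K i) :
    ∀ (k i : ℕ), i + k ≤ n → ∀ r ∈ K (i + k), (fun x => φ x - x)^[k] r ∈ K i := by
  intro k
  induction k with
  | zero => intro i _ r hr; simpa using hr
  | succ k ih =>
    intro i hik r hr
    rw [Function.iterate_succ_apply]
    refine ih i (by omega) _ ?_
    exact hstep (i + k) (by omega) r (by rw [show i + k + 1 = i + (k + 1) by omega]; exact hr)

end LocalRing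

end Summit.ResolutionOfSingularities.ResolutionOfSingularities.Theorems.WildQuotientResolution.UnipotentLevel
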